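import Mathlib
import Summits.Ventures.PercRepro2.Defs
import Summits.Ventures.PercRepro2.CoinDefs

/-!
# The shift identity of the gate functional and the agreeing-shift regime (blind cell PercRepro2,
night-2; proofs/NIGHT2-DARC.md §2.5)

With `P = P(R_T)`, `A = E[X; R_T]`, `B = E[Y; R_T]` and `P_𝓔, A_𝓔, B_𝓔, C_𝓔` the masses on any event
`𝓔` (in particular the gate event), the cleared centred functional satisfies
`P_𝓔 · phiC(𝓔) = P² · covC(𝓔) + (A_𝓔 P − A P_𝓔)(B_𝓔 P − B P_𝓔)`: the (PA-gate) covariance plus the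
product of the two centring shifts `P(𝓔)P(R)·(E[X | 𝓔] − E[X | R])`.  Hence the row is trivial
whenever the two shifts agree in sign (`darc_of_pa_of_shift_nonneg`) — the content of 2′DARC is the
disagreeing regime, where the directed-BHK covariance must dominate the shift product.
-/

namespace Summit.Ventures.PercRepro2.Coin

section Shift

open Classical

variable {V : Type*} {E : Type*} [Fintype E] [DecidableEq E] {R : Type*} [CommRing R]

/-- The shift of the marker `X` on the event `𝒟`, cleared: `P(𝒟)P(R)·(E[X | 𝒟] − E[X | R])`. -/
noncomputable def shiftC (p : E → R) (arcs : E → Finset (V × V)) (s : V) (T : Finset V) (a : V)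
    (D : Set (Config E)) : R :=
  massE p (marker (R := R) arcs s a) D * prob p (avoidEvent arcs s T)
    - massE p (marker (R := R) arcs s a) (avoidEvent arcs s T) * prob p D

/-- **The shift identity**: `P(𝒟)·phiC(𝒟) = P(R)²·covC(𝒟) + shiftC_a(𝒟)·shiftC_b(𝒟)`. -/
theorem phiC_mul_eq (p : E → R) (arcs : E → Finset (V × V)) (s : V) (T : Finset V) (a b : V)
    (D : Set (Config E)) :
    prob p D * phiC p arcs s T a b D =
      prob p (avoidEvent arcs s T) ^ 2 * covC p arcs s a b D
        + shiftC p arcs s T a D * shiftC p arcs s T b D := by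
  simp only [phiC, covC, shiftC]
  ring

end Shift

section Regime

open Classical

variable {V : Type*} {E : Type*} [Fintype E] [DecidableEq E] {R : Type*} [Field R] [LinearOrder R]
  [IsStrictOrderedRing R]

/-- **The agreeing-shift regime is trivial**: on any event `𝒟` of positive probability, if the
covariance on `𝒟` is nonnegative and the two centring shifts have the same sign, the centred
functional is nonnegative. For the gate event this is row 2′DARC from (PA-gate) whenever the shifts
of the two markers agree — the row's content sits entirely in the disagreeing regime. -/
theorem phiC_nonneg_of_shift_nonneg (p : E → R) (arcs : E → Finset (V × V)) (s : V) (T : Finset V)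
    (a b : V) (D : Set (Config E)) (hD : 0 < prob p D) (hcov : 0 ≤ covC p arcs s a b D)
    (hshift : 0 ≤ shiftC p arcs s T a D * shiftC p arcs s T b D) :
    0 ≤ phiC p arcs s T a b D := by
  have h := phiC_mul_eq p arcs s T a b D
  have h2 : 0 ≤ prob p D * phiC p arcs s T a b D := by
    rw [h]
    exact add_nonneg (mul_nonneg (sq_nonneg _) hcov) hshift
  exact (mul_nonneg_iff_of_pos_left hD).mp h2

/-- Row 2′DARC from (PA-gate) in the agreeing-shift regime. -/
theorem darc_of_pa_of_shift_nonneg (p : E → R) (arcs : E → Finset (V × V)) (s : V) (T : Finset V)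
    (a b u w : V) (hE : 0 < prob p (gateEvent arcs s T u w)) (hPA : PAGate p arcs s T a b u w)
    (hshift : 0 ≤ shiftC p arcs s T a (gateEvent arcs s T u w)
      * shiftC p arcs s T b (gateEvent arcs s T u w)) :
    DARC p arcs s T a b u w :=
  phiC_nonneg_of_shift_nonneg p arcs s T a b _ hE hPA hshift

end Regime

end Summit.Ventures.PercRepro2.Coin
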